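/-
Origin: expansion seat `planner-pub-hodgecm-pv14-g6-0`, handover import Pv14g6.SchwartzLinearFlowDeriv -> import HodgeCM.Automorphic.SchwartzLinearFlowDeriv ; import Pv14g6.SchwartzTranslationFlowDeriv -> import HodgeCM.Automorphic.SchwartzTranslationFlowDeriv ; after t31 rows 1 (SchwartzLinearFlowDeriv) and 5 (SchwartzTranslationFlowDeriv) (`HOME/pub-hodgecm-pv14-g6/lean/Pv14g6/SchwartzFlowSmooth.lean`, md5 4c1150a6, 184 lines);
landed by the gen-8 packager in gate run 31 as `HodgeCM/Automorphic/SchwartzFlowSmooth.lean` (import ^import Pv14g6\.SchwartzLinearFlowDeriv[ \t]*$→import HodgeCM.Automorphic.SchwartzLinearFlowDeriv ×1; import ^import Pv14g6\.SchwartzTranslationFlowDeriv[ \t]*$→import HodgeCM.Automorphic.SchwartzTranslationFlowDeriv ×1).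
-/
/-
Copyright: HodgeCM public adjudication package, seat pub-hodgecm-pv14-g6 (DAG-NODE PROVER #14, gen 6).
File #21 of this seat.  Kernel-checked, no new axioms.  Imports files #16 and #20 of this seat and
Mathlib only.
-/
import Summits.HodgeConjecture.HodgeCM.Automorphic.SchwartzLinearFlowDeriv_2
import Summits.HodgeConjecture.HodgeCM.Automorphic.SchwartzTranslationFlowDeriv
import Mathlib.Analysis.Calculus.ContDiff.Deriv
import Mathlib.Analysis.Calculus.IteratedDeriv.Defs

/-!
# Scalar smoothness of one-parameter flows on Schwartz space

The weak (scalar) form of "every Schwartz function is a smooth vector": for every continuous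
`ℝ`-linear map `T : 𝓢(E, F) →L[ℝ] G` into a normed space, every `Φ ∈ 𝓢(E, F)` and

* every one-parameter group of linear automorphisms `L : ℝ → (E ≃L[ℝ] E)` with `L 0 = 1`,
  `L (s + t) = L s ∘ L t` and operator-norm derivative `A` at `0`:
  `s ↦ T (Φ ∘ L s)` is `C^∞` on `ℝ`, with
  `iteratedDeriv k (s ↦ T (Φ ∘ L s)) = s ↦ T ((flowGen A)^[k] (Φ ∘ L s))`
  (`contDiff_apply_compCLM`, `iteratedDeriv_apply_compCLM`; dilations: `contDiff_apply_dilation`);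
* every direction `a : E`: `s ↦ T (τ_{s a} Φ)` (`τ_c Φ = Φ(· - c)`) is `C^∞` on `ℝ`, with
  `iteratedDeriv k (s ↦ T (τ_{s a} Φ)) = s ↦ T ((Ψ ↦ -∂_{a} Ψ)^[k] (τ_{s a} Φ))`
  (`contDiff_apply_compSubConstCLM`, `iteratedDeriv_apply_compSubConstCLM`).

`E`, `F` are arbitrary real normed spaces.  The inputs are the Schwartz-topology derivatives of
files #16 (`hasDerivAt_apply_compCLM`) and #20 (`tendsto_compSubConstCLM_sub_div`); the passage to
`C^∞` is the observation that the derivative has the same shape with `T` replaced by `T ∘ flowGen A`,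
resp. `-(T ∘ ∂_{a})`, followed by induction (`contDiff_succ_iff_deriv`).

Only published mathematics is used (Mathlib); nothing here refers to the objects under adjudication.
-/

noncomputable section

open Filter Topology
open scoped SchwartzMap LineDeriv ContDiff

namespace HodgeCM
namespace SchwartzWeil

variable {E F G : Type*} [NormedAddCommGroup E] [NormedSpace ℝ E] [NormedAddCommGroup F]
  [NormedSpace ℝ F] [NormedAddCommGroup G] [NormedSpace ℝ G]

/-- Induction engine: if along a curve `γ : ℝ → 𝓢(E, F)` every scalar coefficient `s ↦ T (γ s)` has
derivative `(T ∘ N) (γ s)` for a fixed continuous linear `N`, then every scalar coefficient is `C^n`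
and its iterated derivatives are `T (N^[k] (γ s))`. -/
theorem contDiff_apply_of_hasDerivAt_comp {γ : ℝ → 𝓢(E, F)} {N : 𝓢(E, F) →L[ℝ] 𝓢(E, F)}
    (h : ∀ (T : 𝓢(E, F) →L[ℝ] G) (s : ℝ), HasDerivAt (fun s => T (γ s)) (T (N (γ s))) s)
    (n : ℕ) (T : 𝓢(E, F) →L[ℝ] G) : ContDiff ℝ n (fun s => T (γ s)) := by
  induction n generalizing T with
  | zero =>
    have hd : Differentiable ℝ (fun s => T (γ s)) := fun s => (h T s).differentiableAt
    rw [Nat.cast_zero]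
    exact contDiff_zero.2 hd.continuous
  | succ n ih =>
    have hderiv : deriv (fun s => T (γ s)) = fun s => (T.comp N) (γ s) := by
      funext s
      exact (h T s).deriv
    rw [Nat.cast_succ, contDiff_succ_iff_deriv]
    refine ⟨fun s => (h T s).differentiableAt, fun hω => absurd hω (by simp), ?_⟩
    rw [hderiv]
    exact ih (T.comp N)

/-- (Ported verbatim from the HodgeCMPerL package; no docstring in the source.) -/
theorem iteratedDeriv_apply_of_hasDerivAt_comp {γ : ℝ → 𝓢(E, F)} {N : 𝓢(E, F) →L[ℝ] 𝓢(E, F)}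
    (h : ∀ (T : 𝓢(E, F) →L[ℝ] G) (s : ℝ), HasDerivAt (fun s => T (γ s)) (T (N (γ s))) s)
    (k : ℕ) (T : 𝓢(E, F) →L[ℝ] G) :
    iteratedDeriv k (fun s => T (γ s)) = fun s => T (N^[k] (γ s)) := by
  induction k generalizing T with
  | zero =>
    rw [iteratedDeriv_zero]
    rfl
  | succ k ih =>
    have hderiv : deriv (fun s => T (γ s)) = fun s => (T.comp N) (γ s) := by
      funext s
      exact (h T s).deriv
    rw [iteratedDeriv_succ', hderiv, ih (T.comp N)]
    funext s
    rw [ContinuousLinearMap.comp_apply, ← Function.iterate_succ_apply' N k]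

/-- (Ported verbatim from the HodgeCMPerL package; no docstring in the source.) -/
theorem contDiff_infty_apply_of_hasDerivAt_comp {γ : ℝ → 𝓢(E, F)} {N : 𝓢(E, F) →L[ℝ] 𝓢(E, F)}
    (h : ∀ (T : 𝓢(E, F) →L[ℝ] G) (s : ℝ), HasDerivAt (fun s => T (γ s)) (T (N (γ s))) s)
    (T : 𝓢(E, F) →L[ℝ] G) : ContDiff ℝ ∞ (fun s => T (γ s)) :=
  contDiff_infty.2 fun n => contDiff_apply_of_hasDerivAt_comp h n T

/-! ## Linear one-parameter groups -/

section Linear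

variable (𝕜 : Type*) [RCLike 𝕜] [NormedSpace 𝕜 F] [SMulCommClass ℝ 𝕜 F]
variable {L : ℝ → E ≃L[ℝ] E} {A : E →L[ℝ] E}

/-- **Scalar smoothness along linear one-parameter groups.**  For a one-parameter group `L` of linear
automorphisms of `E` with operator-norm generator `A`, every scalar coefficient
`s ↦ T (Φ ∘ L s)` is `C^∞`. -/
theorem contDiff_apply_compCLM (T : 𝓢(E, F) →L[ℝ] G)
    (hL0 : ((L 0 : E ≃L[ℝ] E) : E →L[ℝ] E) = 1)
    (hL : HasDerivAt (fun s => ((L s : E ≃L[ℝ] E) : E →L[ℝ] E)) A 0)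
    (hmul : ∀ s t x, L (s + t) x = L s (L t x)) (Φ : 𝓢(E, F)) :
    ContDiff ℝ ∞ (fun s : ℝ => T (SchwartzMap.compCLMOfContinuousLinearEquiv 𝕜 (L s) Φ)) :=
  contDiff_infty_apply_of_hasDerivAt_comp (N := flowGen A)
    (fun T s => hasDerivAt_apply_compCLM 𝕜 T hL0 hL hmul Φ s) T

/-- The iterated derivatives along a linear one-parameter group:
`(d/ds)^k T (Φ ∘ L s) = T ((flowGen A)^k (Φ ∘ L s))`. -/
theorem iteratedDeriv_apply_compCLM (T : 𝓢(E, F) →L[ℝ] G)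
    (hL0 : ((L 0 : E ≃L[ℝ] E) : E →L[ℝ] E) = 1)
    (hL : HasDerivAt (fun s => ((L s : E ≃L[ℝ] E) : E →L[ℝ] E)) A 0)
    (hmul : ∀ s t x, L (s + t) x = L s (L t x)) (Φ : 𝓢(E, F)) (k : ℕ) :
    iteratedDeriv k (fun s : ℝ => T (SchwartzMap.compCLMOfContinuousLinearEquiv 𝕜 (L s) Φ))
      = fun s => T ((flowGen A)^[k] (SchwartzMap.compCLMOfContinuousLinearEquiv 𝕜 (L s) Φ)) :=
  iteratedDeriv_apply_of_hasDerivAt_comp (N := flowGen A)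
    (fun T s => hasDerivAt_apply_compCLM 𝕜 T hL0 hL hmul Φ s) k T

/-- Dilations: `s ↦ T (Φ(e^s ·))` is `C^∞`, with `k`-th derivative `T (𝔈^k (Φ(e^s ·)))`,
`𝔈 Ψ (x) = DΨ(x)[x]` the Euler operator (`flowGen 1`). -/
theorem contDiff_apply_dilation (T : 𝓢(E, F) →L[ℝ] G) (Φ : 𝓢(E, F)) :
    ContDiff ℝ ∞ (fun s : ℝ => T (SchwartzMap.compCLMOfContinuousLinearEquiv 𝕜 (dilation E s) Φ)) :=
  contDiff_apply_compCLM 𝕜 T (coe_dilation_zero E) (hasDerivAt_coe_dilation E) (dilation_add_apply E) Φ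

/-- (Ported verbatim from the HodgeCMPerL package; no docstring in the source.) -/
theorem iteratedDeriv_apply_dilation (T : 𝓢(E, F) →L[ℝ] G) (Φ : 𝓢(E, F)) (k : ℕ) :
    iteratedDeriv k (fun s : ℝ => T (SchwartzMap.compCLMOfContinuousLinearEquiv 𝕜 (dilation E s) Φ))
      = fun s => T ((flowGen (1 : E →L[ℝ] E))^[k]
          (SchwartzMap.compCLMOfContinuousLinearEquiv 𝕜 (dilation E s) Φ)) :=
  iteratedDeriv_apply_compCLM 𝕜 T (coe_dilation_zero E) (hasDerivAt_coe_dilation E)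
    (dilation_add_apply E) Φ k

end Linear

/-! ## Translation groups -/

section Translation

variable (𝕜 : Type*) [RCLike 𝕜] [NormedSpace 𝕜 F]

/-- The translation derivative at an arbitrary base point `s₀` of the straight line `s ↦ s • a`:
`s⁻¹ • (τ_{(s₀+s) a} Φ - τ_{s₀ a} Φ) → -∂_{a} (τ_{s₀ a} Φ)` in `𝓢(E, F)`. -/
theorem tendsto_compSubConstCLM_smul_sub_div_at' (a : E) (Φ : 𝓢(E, F)) (s₀ : ℝ) :
    Tendsto (fun s : ℝ => s⁻¹ • (SchwartzMap.compSubConstCLM 𝕜 ((s₀ + s) • a) Φ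
        - SchwartzMap.compSubConstCLM 𝕜 (s₀ • a) Φ)) (𝓝[≠] 0)
      (𝓝 (-(∂_{a} (SchwartzMap.compSubConstCLM 𝕜 (s₀ • a) Φ)))) := by
  have key : ∀ s : ℝ, SchwartzMap.compSubConstCLM 𝕜 ((s₀ + s) • a) Φ
      = SchwartzMap.compSubConstCLM 𝕜 (s • a) (SchwartzMap.compSubConstCLM 𝕜 (s₀ • a) Φ) := by
    intro s
    rw [add_smul, SchwartzMap.compSubConstCLM_comp]
  simp only [key]
  exact tendsto_compSubConstCLM_smul_sub_div' 𝕜 a _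

/-- Scalar coefficients along a translation line are differentiable everywhere:
`d/ds T (τ_{s a} Φ) |_{s₀} = -T (∂_{a} (τ_{s₀ a} Φ))`. -/
theorem hasDerivAt_apply_compSubConstCLM (T : 𝓢(E, F) →L[ℝ] G) (a : E) (Φ : 𝓢(E, F)) (s₀ : ℝ) :
    HasDerivAt (fun s : ℝ => T (SchwartzMap.compSubConstCLM 𝕜 (s • a) Φ))
      (-(T (∂_{a} (SchwartzMap.compSubConstCLM 𝕜 (s₀ • a) Φ)))) s₀ := by
  rw [hasDerivAt_iff_tendsto_slope_zero]
  have h := (T.continuous.tendsto _).comp (tendsto_compSubConstCLM_smul_sub_div_at' 𝕜 a Φ s₀)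
  rw [map_neg] at h
  refine h.congr fun s => ?_
  simp only [Function.comp_apply, map_smul, map_sub]

/-- **Scalar smoothness along translation groups.**  For every direction `a`, every scalar coefficient
`s ↦ T (τ_{s a} Φ)` is `C^∞` on `ℝ`. -/
theorem contDiff_apply_compSubConstCLM (T : 𝓢(E, F) →L[ℝ] G) (a : E) (Φ : 𝓢(E, F)) :
    ContDiff ℝ ∞ (fun s : ℝ => T (SchwartzMap.compSubConstCLM 𝕜 (s • a) Φ)) := by
  refine contDiff_infty_apply_of_hasDerivAt_comp
    (N := -(LineDeriv.lineDerivOpCLM ℝ 𝓢(E, F) a)) (fun T s => ?_) T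
  have h := hasDerivAt_apply_compSubConstCLM 𝕜 T a Φ s
  rwa [← map_neg] at h

/-- The iterated derivatives along a translation line:
`(d/ds)^k T (τ_{s a} Φ) = T ((Ψ ↦ -∂_{a} Ψ)^k (τ_{s a} Φ))`. -/
theorem iteratedDeriv_apply_compSubConstCLM (T : 𝓢(E, F) →L[ℝ] G) (a : E) (Φ : 𝓢(E, F)) (k : ℕ) :
    iteratedDeriv k (fun s : ℝ => T (SchwartzMap.compSubConstCLM 𝕜 (s • a) Φ))
      = fun s => T ((fun Ψ : 𝓢(E, F) => -(∂_{a} Ψ))^[k] (SchwartzMap.compSubConstCLM 𝕜 (s • a) Φ)) := by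
  have h := iteratedDeriv_apply_of_hasDerivAt_comp (G := G)
    (γ := fun s : ℝ => SchwartzMap.compSubConstCLM 𝕜 (s • a) Φ)
    (N := -(LineDeriv.lineDerivOpCLM ℝ 𝓢(E, F) a)) (fun T s => ?_) k T
  · exact h
  · have h := hasDerivAt_apply_compSubConstCLM 𝕜 T a Φ s
    rwa [← map_neg] at h

end Translation

end SchwartzWeil
end HodgeCM
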